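import Summits.AtomisticToContinuum.BoseEinsteinCondensation.Theorems.BECThomsonPrinciplePeriodicToDirichletDefs
import Literature.MathematicalPhysics.QuantumManyBody.BoseGasSlabPadding

/-!
# Route `BECThomsonPrinciple`, crux `PeriodicToDirichlet` (stmt-AtomisticToContinuum-9483),
# line `reward-pays-the-wall` — stub `stub_paddedCutoffState`

The ASSEMBLY of the padded cut-off state at the same density (registered stub 1d of the line's
skeleton): from the five stub statements `CutoffEnergy`, `PaddingStates`, `FlatModeNested`,
`CutoffOccupation`, `MergeOccupation` of the Defs file
`Theorems/BECThomsonPrinciplePeriodicToDirichletDefs.lean` (proved by the neighbouring stub files)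
we build, for every periodic `N`-body trial state `Ψ` on the torus of side `L = L_N(ρ)` and every
`N'' ∈ [(1 + 7/M)N, (1 + 7/M)N + 3]`, a Dirichlet trial state of `N''` bosons in the box of side
exactly `L_{N''}(ρ)` with energy `≤ (1 + θ)⟨Ψ,HΨ⟩_per + C(1 + N/L²) + θN` and flat-mode occupation
`≥ (N/N'')² (n₀(Ψ) - θN)`.

Construction (geometry and bookkeeping only, no analysis): `L = 2ℓM`, the cut-off state `Φ_0`
(raw lambda of `DiluteBoseGasUpperBoundLocalization`, profile of `exists_smooth_cutoff`) lives in
`Λ_{L(1+1/M)}`; its energy is bounded by `CutoffEnergy` (`η = θ/(C+1)`, `D = c/ℓ = 2cM/L`), its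
flat-mode occupation by `CutoffOccupation` (`C√(1/(2M)) ≤ θ`); it is merged
(`SupportedState.merge`, `rawEnergy_merge`) with `m = N'' - N ≤ 7N/M + 3` bosons placed by
`PaddingStates` in `R`-separated unit cells `subBox 1 (1+R) d` of the slab
`{L(1+1/M) + R < x₀ < L''}` of the box `Λ_{L''}`, `L'' = L_{N''}(ρ) ≥ (1 + 2/M)L` (as
`(1 + 2/M)³ ≤ 1 + 7/M` for `M ≥ 13`), which has room for `≥ N/(8ρM(1+R)³) ≥ 10N/M ≥ m` cells once
`ρ ≤ 1/(80(1+R)³)` and `L ≥ 4M(1+R)`; the occupation passes through `MergeOccupation` and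
`FlatModeNested` (`(L'/L'')³(L/L')³ = (L/L'')³ = N/N''`, `sideLength_pow_three`).

References: Basti–Cenatiempo–Schlein 2021, App. A (cut-off); Ruelle 1969, §3.5.11 (merging of
Dirichlet states with separated supports); LSSY 2005, §1.2 (1.17)–(1.19).
-/

noncomputable section

open MeasureTheory Filter
open scoped ENNReal NNReal

namespace Summit.AtomisticToContinuum.BoseEinsteinCondensation.RewardPaysTheWall

open Literature.MathematicalPhysics.QuantumManyBody.BoseGas

/-! ## Bookkeeping helpers (real and `ℝ≥0∞` arithmetic) -/

/-- The energy bookkeeping: `C₁x + m e₁ + 1 ≤ (C₁ + 3e₁ + 1)(1 + x) + θN` when `m ≤ 7N/M + 3` and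
`7e₁ ≤ Mθ`. [folklore] -/
private theorem energy_bookkeeping {C₁ e₁ θ M N m x : ℝ} (hC₁ : 0 ≤ C₁) (he₁ : 0 ≤ e₁)
    (hx : 0 ≤ x) (hN : 0 ≤ N) (hM : 0 < M) (h7 : 7 * e₁ ≤ M * θ) (hm : m ≤ 7 * N / M + 3) :
    C₁ * x + m * e₁ + 1 ≤ (C₁ + 3 * e₁ + 1) * (1 + x) + θ * N := by
  have h1 : m * e₁ ≤ (7 * N / M + 3) * e₁ := mul_le_mul_of_nonneg_right hm he₁
  have h2 : 7 * N / M * e₁ ≤ θ * N := by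
    rw [div_mul_eq_mul_div, div_le_iff₀ hM]
    nlinarith [mul_le_mul_of_nonneg_left h7 hN]
  nlinarith [mul_nonneg hC₁ hx, mul_nonneg he₁ hx]

/-- The occupation threshold: `C√(1/(2M)) ≤ θ` once `C² ≤ 2Mθ²`. [folklore] -/
private theorem mul_sqrt_le_of_sq_le {C θ M : ℝ} (hθ : 0 < θ) (hM : 0 < M)
    (h : C ^ 2 ≤ 2 * M * θ ^ 2) : C * Real.sqrt (1 / (2 * M)) ≤ θ := by
  have hs := Real.sq_sqrt (show (0 : ℝ) ≤ 1 / (2 * M) by positivity)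
  refine le_of_pow_le_pow_left₀ two_ne_zero hθ.le ?_
  rw [mul_pow, hs]
  calc C ^ 2 * (1 / (2 * M)) = C ^ 2 / (2 * M) := by ring
    _ ≤ θ ^ 2 := by rw [div_le_iff₀ (by positivity)]; linarith

/-- The squared particle ratio is below the volume ratio: `(n/n'')² ≤ (L'/L'')³ (L/L')³` when
`L³/L''³ = n/n'' ≤ 1`. [folklore] -/
private theorem ratio_sq_le {L L' L'' n n'' : ℝ} (hL : 0 < L) (hL' : 0 < L') (hL'' : 0 < L'')
    (hn : 0 ≤ n) (hnn : n ≤ n'') (h3 : L ^ 3 / L'' ^ 3 = n / n'') :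
    (n / n'') ^ 2 ≤ (L' / L'') ^ 3 * (L / L') ^ 3 := by
  have h1 : (L' / L'') ^ 3 * (L / L') ^ 3 = n / n'' := by
    rw [← h3, ← mul_pow, ← div_pow]
    congr 1
    field_simp
  rw [h1]
  rcases eq_or_lt_of_le (hn.trans hnn) with h0 | h0
  · rw [← h0, div_zero]; norm_num
  · exact pow_le_of_le_one (div_nonneg hn h0.le) (div_le_one_of_le₀ hnn h0.le) two_ne_zero

/-- Energy bookkeeping in `ℝ≥0∞`: cut-off energy plus padding energy. [folklore] -/
private theorem energy_total {E Eper Epad : ℝ≥0∞} {θ C₁ e₁ x M N : ℝ} {m : ℕ} (hC₁ : 0 ≤ C₁)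
    (he₁ : 0 ≤ e₁) (hx : 0 ≤ x) (hN : 0 ≤ N) (hM : 0 < M) (h7 : 7 * e₁ ≤ M * θ)
    (hm : (m : ℝ) ≤ 7 * N / M + 3)
    (hEb : E ≤ (1 + ENNReal.ofReal θ) * Eper + ENNReal.ofReal (C₁ * x))
    (hpad : Epad ≤ (m : ℝ≥0∞) * ENNReal.ofReal e₁ + 1) :
    E + Epad ≤ (1 + ENNReal.ofReal θ) * Eper +
      ENNReal.ofReal ((C₁ + 3 * e₁ + 1) * (1 + x) + θ * N) := by
  have hreal := energy_bookkeeping hC₁ he₁ hx hN hM h7 hm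
  have h1 : (m : ℝ≥0∞) * ENNReal.ofReal e₁ + 1 = ENNReal.ofReal (m * e₁ + 1) := by
    rw [ENNReal.ofReal_add (by positivity) zero_le_one, ENNReal.ofReal_one,
      ENNReal.ofReal_mul (Nat.cast_nonneg _), ENNReal.ofReal_natCast]
  have h2 : ENNReal.ofReal (C₁ * x) + ENNReal.ofReal (m * e₁ + 1) =
      ENNReal.ofReal (C₁ * x + (m * e₁ + 1)) :=
    (ENNReal.ofReal_add (by positivity) (by positivity)).symm
  calc E + Epad ≤ ((1 + ENNReal.ofReal θ) * Eper + ENNReal.ofReal (C₁ * x)) +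
        ((m : ℝ≥0∞) * ENNReal.ofReal e₁ + 1) := add_le_add hEb hpad
    _ = (1 + ENNReal.ofReal θ) * Eper + ENNReal.ofReal (C₁ * x + (m * e₁ + 1)) := by
        rw [h1, add_assoc, h2]
    _ ≤ _ := add_le_add le_rfl (ENNReal.ofReal_le_ofReal (by linarith))

/-- Occupation bookkeeping in `ℝ≥0∞`: `CutoffOccupation`, `FlatModeNested`, `MergeOccupation`
chained. [folklore] -/
private theorem occupation_total {n₀ t t' occ' occ'' occF : ℝ≥0∞} {a b r : ℝ} (hb : 0 ≤ b)
    (hr : r ≤ b * a) (htt' : t' ≤ t) (h2 : ENNReal.ofReal a * (n₀ - t') ≤ occ')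
    (h3 : occ'' = ENNReal.ofReal b * occ') (h4 : occ'' ≤ occF) :
    ENNReal.ofReal r * (n₀ - t) ≤ occF := by
  calc ENNReal.ofReal r * (n₀ - t) ≤ ENNReal.ofReal (b * a) * (n₀ - t') :=
        mul_le_mul' (ENNReal.ofReal_le_ofReal hr) (tsub_le_tsub_left htt' _)
    _ = ENNReal.ofReal b * (ENNReal.ofReal a * (n₀ - t')) := by rw [ENNReal.ofReal_mul hb, mul_assoc]
    _ ≤ ENNReal.ofReal b * occ' := mul_le_mul' le_rfl h2
    _ = occ'' := h3.symm
    _ ≤ occF := h4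

/-- **The cut-off state** in the box `Λ_{L+2ℓ}`, `ℓ = L/(2M)`, with its energy bound
(`CutoffEnergy`, `η = θ/(C+1)`, `D = c/ℓ`) and its flat-mode occupation bound (`CutoffOccupation`),
for the profile of `exists_smooth_cutoff`; the state is the raw cut-off lambda of
`DiluteBoseGasUpperBoundLocalization` (`contDiff_cutoffState`, `mem_box_of_cutoffState_ne_zero`,
`cutoffState_comp_perm`, `lintegral_ennnorm_cutoffState_sq`). [folklore] -/
private theorem exists_cutoff_trialState (hCE : CutoffEnergy) (hCO : CutoffOccupation) :
    ∃ C_E C_O c : ℝ, 0 ≤ C_E ∧ 0 ≤ C_O ∧ 0 ≤ c ∧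
      ∀ (v : ℝ → ℝ≥0∞), Measurable v → ∀ (θ M L ℓ : ℝ), 0 < θ → 1 ≤ M → 0 < L →
        ℓ = L / (2 * M) → ∀ (N : ℕ) (Ψ : PeriodicTrialState N L),
          ∃ Φ : TrialState N (L + 2 * ℓ),
            energy v Φ ≤ (1 + ENNReal.ofReal θ) * periodicEnergy v Ψ +
                ENNReal.ofReal (4 * C_E * (1 + (θ / (C_E + 1))⁻¹) * c ^ 2 * M ^ 2 *
                  (N / L ^ 2)) ∧
              ENNReal.ofReal ((L / (L + 2 * ℓ)) ^ 3) *
                  (condensateOccupation N L Ψ.ψ -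
                    ENNReal.ofReal (C_O * Real.sqrt (1 / (2 * M)) * N)) ≤
                occupation N (boxConstantMode (L + 2 * ℓ)) Φ.ψ ∧
              ∀ X, Φ.ψ X ≠ 0 → ∀ i, X i ∈ box (L + 2 * ℓ) := by
  obtain ⟨C_E, hCE0, hCE⟩ := hCE
  obtain ⟨C_O, hCO0, hCO⟩ := hCO
  obtain ⟨c, hc0, hcut⟩ := exists_smooth_cutoff
  refine ⟨C_E, C_O, c, hCE0, hCO0, hc0, fun v hv θ M L ℓ hθ hM hL hℓdef N Ψ => ?_⟩
  have hM0 : 0 < M := by linarith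
  have hℓ : 0 < ℓ := by rw [hℓdef]; positivity
  have h2ℓ : 2 * ℓ ≤ L := by
    rw [hℓdef, show 2 * (L / (2 * M)) = L / M by field_simp]
    exact div_le_self hL.le hM
  obtain ⟨q, hq, hq01, hqsupp, hpu, hqD, hramp⟩ := hcut ℓ L hℓ h2ℓ
  set η : ℝ := θ / (C_E + 1) with hηdef
  have hη : 0 < η := by positivity
  obtain ⟨Φ, hΦ⟩ : ∃ Φ : TrialState N (L + 2 * ℓ), Φ.ψ = fun X : Config N =>
      Ψ.ψ (X + fun _ => (0 : Space)) * ((∏ p : Fin N × Fin 3, q (X p.1 p.2) : ℝ) : ℂ) :=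
    ⟨⟨fun X : Config N => Ψ.ψ (X + fun _ => (0 : Space)) *
        ((∏ p : Fin N × Fin 3, q (X p.1 p.2) : ℝ) : ℂ),
      contDiff_cutoffState hq Ψ.contDiff _,
      fun X hX => Classical.not_not.1 fun h => hX fun i =>
        mem_box_of_cutoffState_ne_zero hqsupp Ψ.ψ _ X h i,
      fun σ X => cutoffState_comp_perm Ψ.symm 0 σ X,
      lintegral_ennnorm_cutoffState_sq hL hq.continuous (fun t => (hq01 t).1) hpu Ψ 0⟩, rfl⟩
  refine ⟨Φ, ?_, ?_, fun X hX i => ?_⟩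
  · -- energy
    have h := hCE N ℓ L (c / ℓ) q v η 0 hℓ h2ℓ hv hη hq hq01 hpu hqD hramp Ψ
    rw [energy, hΦ]
    refine h.trans (add_le_add ?_ (le_of_eq ?_))
    · gcongr
      rw [hηdef, mul_div_assoc']
      exact div_le_of_le_mul₀ (by positivity) hθ.le (by nlinarith)
    · congr 1
      rw [hℓdef]
      field_simp
      ring
  · -- flat-mode occupation
    have h := hCO N ℓ L q hℓ h2ℓ hq.continuous hq01 hqsupp hpu Ψ
    rw [hΦ]
    have h0 : ℓ / L = 1 / (2 * M) := by rw [hℓdef]; field_simp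
    rw [h0, mul_right_comm] at h
    refine (mul_le_mul' le_rfl (tsub_le_iff_right.2 h)).trans_eq ?_
    rw [← mul_assoc, ← ENNReal.ofReal_mul (by positivity), ← mul_pow,
      show L / (L + 2 * ℓ) * ((L + 2 * ℓ) / L) = 1 by field_simp, one_pow, ENNReal.ofReal_one,
      one_mul]
  · -- support
    rw [hΦ] at hX
    exact mem_box_of_cutoffState_ne_zero hqsupp Ψ.ψ _ X hX i

/-! ## The registered stub -/

/-- **Stub 1d `stub_paddedCutoffState`** (registered signature): the assembly of the padded
cut-off state at the same density from `CutoffEnergy`, `PaddingStates`, `FlatModeNested`,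
`CutoffOccupation`, `MergeOccupation` — see `PaddedCutoffState` and the module docstring for the
construction (cut-off state in `Λ_{L(1+1/M)}`, merged with `N'' - N` one-particle padding states in
`R`-separated unit cells of the slab `{L(1+1/M) + R < x₀ < L_{N''}(ρ)}`; Basti–Cenatiempo–Schlein
2021 App. A, Ruelle 1969 §3.5.11). [folklore] -/
theorem stub_paddedCutoffState :
    CutoffEnergy → PaddingStates → FlatModeNested → CutoffOccupation → MergeOccupation →
      PaddedCutoffState := by
  intro hCE hPS hFMN hCO hMO v hv
  obtain ⟨R, hR, hvR⟩ := hv.exists_pos_range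
  refine ⟨1 / (80 * (1 + R) ^ 3), by positivity, fun ρ hρ hρbar θ hθ => ?_⟩
  obtain ⟨C_E, C_O, c, hCE0, hCO0, hc0, hcut⟩ := exists_cutoff_trialState hCE hCO
  have hE₁ : groundStateEnergy v 1 1 < ⊤ := groundStateEnergy_one_lt_top v one_pos
  set e₁ : ℝ := (groundStateEnergy v 1 1).toReal with he₁def
  have hE₁eq : groundStateEnergy v 1 1 = ENNReal.ofReal e₁ := (ENNReal.ofReal_toReal hE₁.ne).symm
  -- the threshold `M₀`
  obtain ⟨M₀, hM₀⟩ := exists_nat_ge (max 13 (max (7 * e₁ / θ) (C_O ^ 2 / (2 * θ ^ 2))))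
  refine ⟨M₀, fun M hM => ?_⟩
  have hMr : max 13 (max (7 * e₁ / θ) (C_O ^ 2 / (2 * θ ^ 2))) ≤ (M : ℝ) :=
    hM₀.trans (by exact_mod_cast hM)
  have hM13 : (13 : ℝ) ≤ M := le_of_max_le_left hMr
  have hMpos : (0 : ℝ) < M := by linarith
  have hM7 : 7 * e₁ ≤ M * θ :=
    (div_le_iff₀ hθ).1 (le_of_max_le_left (le_of_max_le_right hMr))
  have hMC : C_O ^ 2 ≤ 2 * M * θ ^ 2 := by
    have h := (div_le_iff₀ (by positivity)).1 (le_of_max_le_right (le_of_max_le_right hMr))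
    linarith
  set C₁ : ℝ := 4 * C_E * (1 + (θ / (C_E + 1))⁻¹) * c ^ 2 * M ^ 2 with hC₁def
  have hη : 0 < θ / (C_E + 1) := by positivity
  have hC₁ : 0 ≤ C₁ := by positivity
  refine ⟨C₁ + 3 * e₁ + 1, ?_⟩
  -- the threshold `N₀`: `L_N ≥ 4M(1+R)`
  obtain ⟨N₀, hN₀⟩ := eventually_atTop.1
    ((tendsto_sideLength_atTop hρ).eventually_ge_atTop (4 * M * (1 + R)))
  refine ⟨max N₀ 1, fun N N'' hN hlo hhi => ?_⟩
  have hN1 : 1 ≤ N := le_of_max_le_right hN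
  have hNr : (0 : ℝ) < N := by exact_mod_cast hN1
  -- `N'' = N + m`
  have hNN'' : N ≤ N'' := by
    have h1 : (N : ℝ) ≤ (1 + 7 / (M : ℝ)) * N := by
      have : (0 : ℝ) ≤ 7 / (M : ℝ) * N := by positivity
      linarith
    exact_mod_cast h1.trans hlo
  obtain ⟨m, rfl⟩ := Nat.exists_eq_add_of_le hNN''
  push_cast at hlo hhi ⊢
  have hm7 : (m : ℝ) ≤ 7 * N / M + 3 := by
    have : (1 + 7 / (M : ℝ)) * N = N + 7 * N / M := by ring
    linarith
  -- the boxes `L = L_N`, `L'' = L_{N+m} ≥ (1 + 2/M) L`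
  set L : ℝ := sideLength ρ N with hLdef
  set L'' : ℝ := sideLength ρ (N + m) with hL''def
  have hL4 : 4 * M * (1 + R) ≤ L := hN₀ N (le_of_max_le_left hN)
  have hL0 : 0 < L := Real.rpow_pos_of_pos (div_pos hNr hρ) _
  have hL3 : L ^ 3 = N / ρ := sideLength_pow_three hρ N
  have hL''3 : L'' ^ 3 = (N + m : ℝ) / ρ := by
    rw [hL''def, sideLength_pow_three hρ (N + m)]; push_cast; rfl
  have hNL : (N : ℝ) = ρ * L ^ 3 := by rw [hL3]; field_simp
  have hL''ge : (1 + 2 / M) * L ≤ L'' := by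
    refine one_add_two_div_mul_le_of_cube hM13 hL0.le (sideLength_nonneg hρ.le _) ?_
    rw [hL3, hL''3, ← mul_div_assoc]
    exact div_le_div_of_nonneg_right hlo hρ.le
  have hL''0 : 0 < L'' := lt_of_lt_of_le (by positivity) hL''ge
  -- the cut-off state in the box of side `L + 2ℓ = L(1 + 1/M)`
  intro Ψ
  set ℓ : ℝ := L / (2 * M) with hℓdef
  obtain ⟨Φb, hEb, hOb, hΦbsupp⟩ := hcut v hv.1 θ M L ℓ hθ (by linarith) hL0 hℓdef N Ψ
  have h2ℓ : 2 * ℓ = L / M := by rw [hℓdef]; field_simp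
  have hL'0 : 0 < L + 2 * ℓ := by rw [h2ℓ]; positivity
  have hLL' : L ≤ L + 2 * ℓ := by rw [h2ℓ]; linarith [div_nonneg hL0.le hMpos.le]
  have hgap : L / M ≤ L'' - (L + 2 * ℓ) := by
    rw [h2ℓ]
    have : (1 + 2 / M) * L = L + L / M + L / M := by ring
    linarith
  have hL'L'' : L + 2 * ℓ ≤ L'' := by linarith [div_nonneg hL0.le hMpos.le]
  -- the padding cells and the padding state
  obtain ⟨d, hdinj, hcell, hsep0⟩ := exists_slab_cells (m := m) hR (by linarith) hL4 hLL' hgap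
    hρ.le ((le_div_iff₀ (by positivity)).1 hρbar) (by rw [← hNL]; exact hm7)
  obtain ⟨Ψpad, hΨpad⟩ : ∃ Ψpad : SupportedState m (⋃ j, subBox 1 (1 + R) (d j)),
      rawEnergy v Ψpad.ψ < m * groundStateEnergy v 1 1 + 1 :=
    iInf_lt_iff.1 ((hPS v R hv.1 hvR hR.le m d hdinj).trans_lt
      (ENNReal.lt_add_right (ENNReal.mul_ne_top (ENNReal.natCast_ne_top m) hE₁.ne) one_ne_zero))
  -- merging
  have hsep : ∀ x ∈ box (L + 2 * ℓ), ∀ y ∈ ⋃ j, subBox 1 (1 + R) (d j), R < dist x y := by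
    intro x hx y hy
    rw [Set.mem_iUnion] at hy
    obtain ⟨j, hy⟩ := hy
    exact lt_dist_box_subBox_of_le (hsep0 j) hx hy
  have hdisj : Disjoint (box (L + 2 * ℓ)) (⋃ j, subBox 1 (1 + R) (d j)) :=
    Set.disjoint_left.2 fun x hx hy => by
      have h := hsep x hx x hy
      rw [dist_self] at h
      exact absurd h (not_lt.2 hR.le)
  have hsub : box (L + 2 * ℓ) ∪ (⋃ j, subBox 1 (1 + R) (d j)) ⊆ box L'' :=
    Set.union_subset (box_subset_box hL'L'')
      (Set.iUnion_subset fun j => subBox_one_subset_box_of_le (by linarith) (hcell j))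
  refine ⟨((Φb.toSupported.merge Ψpad hdisj).mono hsub).toTrialState, ?_, ?_⟩
  · -- energy
    calc energy v ((Φb.toSupported.merge Ψpad hdisj).mono hsub).toTrialState
        = energy v Φb + rawEnergy v Ψpad.ψ :=
          rawEnergy_merge Φb.toSupported Ψpad hdisj hv.1 hvR hsep
      _ ≤ _ := by
          refine energy_total hC₁ ENNReal.toReal_nonneg (by positivity) hNr.le hMpos hM7 hm7 hEb ?_
          rw [← hE₁eq]
          exact hΨpad.le
  · -- flat-mode occupation
    have hth : ENNReal.ofReal (C_O * Real.sqrt (1 / (2 * M)) * N) ≤ ENNReal.ofReal (θ * N) :=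
      ENNReal.ofReal_le_ofReal
        (mul_le_mul_of_nonneg_right (mul_sqrt_le_of_sq_le hθ hMpos hMC) hNr.le)
    refine occupation_total (by positivity) (ratio_sq_le hL0 hL'0 hL''0 hNr.le
      (by linarith) ?_) hth hOb (hFMN hL'0 hL'L'' Φb.ψ hΦbsupp)
      (hMO hdisj (_root_.AtomisticToContinuum.BECInfraredBound.measurableSet_box _)
        (MeasurableSet.iUnion fun j => measurableSet_subBox _ _ _) Φb.toSupported Ψpad
        (boxConstantMode L'')
        (_root_.AtomisticToContinuum.BECInfraredBound.aestronglyMeasurable_constMode L''))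
    rw [hL3, hL''3]
    field_simp

end Summit.AtomisticToContinuum.BoseEinsteinCondensation.RewardPaysTheWall

end
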